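import Summits.ABC.IUTFork.Cor312PilotKummerCompat
import Summits.ABC.IUTFork.Cor312StatementPilotNouns
import Summits.ABC.IUTFork.Repair.CandInternal2
import Summits.ABC.IUTFork.Repair.EvalComparison
import HarnessLib

/-!
# D-0123(C) IUT REPAIR-CATALOGUE (rung LADDER-ABC:A2), NEW row RC-308 — Mochizuki, slides «On the formalization of IUT: a preliminary
# progress report» (RIMS, April 2026), §4 «Skeletal Lean code for “3.11.5 ⟹ 3.12”»: the RE-CUT «3.11.5 := 3.11 + Rmk. 3.9.5 (hull+det)»,
# typed as a claim-tagged hypothesis, with its KERNEL-CLOSE cells (tester abc-iut-rcat-tst-8; KEY file wake/KEY-abc-iut-rcat-tst-8-RC-308.md)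

Record file (D-0012) of the abc-iut cell. TAKES NO SIDE on [IUTchIII] Cor. 3.12 / [IUTchIV] Thm. 1.10 or on any author (D-0045);
nothing here asserts abc proved or refuted. The row is a READING proposed in the literature; every `def` below is a `Prop`-valued
HYPOTHESIS over the frozen vocabulary (`Cor312.Setting`, `Thm311.FullSituation`, the PR-1 binders `ρ`, `qK`), never a Literature
fact, never asserted; typed ≠ proved; located ≠ adjudicated; refuted-AS-TYPED ≠ refuted-in-print («KILLED» = the typed hypothesis
fails the named kernel test at OUR interface). Frozen files are IMPORTED and consumed BY NAME; no new `Prop` fact; standard axioms.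

## THE SOURCE (cell render `HOME/lit/renders/FormalizationSlides2026-04-url-48418130e50d/`, private lit key paper:url-48418130e50d)
* p. 10 (diagram of species/mutations): «BPS —mlt. algo.→ mlt. rep. —hull+det→ mlt. rep. + hull+det», with «(dsc)», «(HDD)»,
  «(HDD) ∘ (SHE)», «BPS + etHT ←(SHE)— q-plt. + etHT»; p. 10 l. 37–43: «the third △ simply expresses the definition of the composite
  arrow (HDD) := (hull+det) ∘ (dsc) obtained by composing the descent-arrow (dsc) … with a certain elementary operation “hull+det”
  (obtained essentially by taking the determinant of the module over a ring generated by a certain topological module that appears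
  in the multiradial representation)»; p. 10 l. 44–51: «the fourth △ expresses the composite (HDD) ∘ (SHE) … the special case where
  the input data “BPS+etHT” of (HDD) is taken — by applying the “SHE-arrow (SHE)” … — to be the data given by the q-pilot».
* p. 11 l. 2–9: «The skeletal Lean code … concerns the fourth △ …, i.e., the simultaneous comparison relative to a single ring
  structure … of · the Θ-pilot — which corresponds to (HDD) … — and · the q-pilot — which corresponds to (SHE)»; p. 11 l. 25–33:
  «We shall refer to this final portion as “3.11.5 ⟹ 3.12” (although in fact “3.11.5 (= 3.11 + Rmk. 3.9.5)” never appears in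
  [IUTchI-IV]!). At a more technical level, this reorgan./decomp. is obtained by “moving” the “hull+det” in 3.12 to “3.11.5”, thus
  making it possible to concentrate, in “3.11.5 ⟹ 3.12”, on the crucial simultaneous comparison aspect of 3.12»; l. 33–36 «This
  aspect also involves the input prime-strip link (IPL) property»; closing diagram p. 11: «Thm. 3.11: (dsc) =[APT + IPL]⇒ “Thm.
  3.11.5”: (hull+det) ∘ (dsc) =[SHE + IPL]⇒ Cor. 3.12: comparison of q-, Θ-plts.». The Lean code itself is NOT released (p. 3
  l. 33–36 «still in a somewhat skeletal/bare bones form … before … suitable for release»).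
* «hull+det» in print = [IUTchIII] Rmk. 3.9.5 (vii) (kurims `paper:url-4b091feeb646` p. 131 l. 36 – p. 133 l. 8): (Ob2) «by passing
  from an arbitrary given region ∈ P to the associated hull φ(P) ∈ H, we obtain a region … stabilized by the natural action of 𝒪^×_k
  … [which] may be regarded as defining the local portion of a global arithmetic vector bundle»; (Ob3) «by forming the determinant of
  the arithmetic vector bundle constituted by a hull ∈ H, one obtains an arithmetic line bundle»; (Ob3-3) p. 132 l. 48 – p. 133 l. 8
  «the arithmetic degree of such an arithmetic line bundle may be interpreted … as the log-volume of the original arithmetic vector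
  bundle … this intermediate step of applying det^{⊗M}(−) may be omitted in discussions in which one is only interested in computing
  log-volumes»; (Ob5) p. 134 l. 26–47 «working with the hull φ(P_B) associated to the [bounded] collection of possible regions P_B».

## THE TYPING (this seat's reading; the referee lanes grade FAITHFUL / PARAPHRASE)
«hull+det» is an OPERATION on the multiradial representation — Θ-SIDE ONLY: form the holomorphic hull `ⁿ˒°𝒰_{j,v_ℚ}` of the union of
the possible images (`Cor312.Setting.thetaHull`, already a DEFINITION of the frozen setting) and take its determinant = arithmetic
degree = log-volume (`Cor312.Setting.thetaLocal` / `negLogTheta`, also DEFINITIONS). As a PROPOSITION, what «3.11 + Rmk. 3.9.5»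
asserts beyond the typed Theorem 3.11 is therefore that this output EXISTS as a real number: the union of possible images at every
label of `𝔽_l^⋇` is relatively compact and admits its hull, and the hull volumes are finitely supported — BY NAME the frozen
`Cor312.Setting.ThetaFinite` («−|log(Θ)| ∈ ℝ»). Hence **`HullDet P := P.ThetaFinite`** and **`Thm3115 F P := F.Statement ∧ HullDet P`**;
the container strengthening of abc-iut-rcat-tst-2's pre-work (KERNEL-CLOSE-REF-LIT.md §6 row A8: + RP-I05 `CandInternal2.HInd3Hull`)
is `Thm3115Plus`. The 4th △ «3.11.5 ⟹ 3.12» is typed as the CLAUSE `Imp3115 F P := Thm3115 F P → P.Statement`, and — with the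
slide's «SHE + IPL» read as the q-pin + the object-level link pin of PR-1 (`Cor312Vol.PinnedRegions3`) — as `Imp3115SheIpl`.
HullDet is NOT one of the comparison clauses S_H-hull `Cor312Vol.PilotKummerCompatHull` (RC-032) / `Cor312Vol.GlobalVolumeTransport`
(RC-131 vehicle) / the (xi-f) `Licence`: those compare the q-pilot with the Θ-side and belong to «3.11.5 ⟹ 3.12», and §4 separates
them from HullDet in the kernel (HullDet holds where all three fail).

## KERNEL-CLOSE CELLS (this file)
§2 HullDet is NECESSARY and cheap: `Statement → HullDet`, `BridgeHyps → HullDet`. §3 k4: given 3.11.5, the clause «3.11.5 ⟹ 3.12»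
⟺ the Statement (`imp3115_iff_statement`) — the re-cut moves ALL disputed content into the 4th △ (= the open node (xi-f) of record,
`Cor312Proof.xi_f_holds_honest_iff_statement` p418650, not re-derived here). §4 T-b at abc-iut-w4-d101's pinned countermodel
(`Cor312Vol.PinnedWitness.pinned_countermodel` p419720; every prime `p`, literally `p = 2`): `Thm3115` and `Thm3115Plus` HOLD there
together with `BridgeHyps`, `AbsLogQPos`, `PinnedRegions3` (= SHE + object-level IPL) and `¬PilotKummerCompatHull ∧
¬GlobalVolumeTransport ∧ ¬Licence ∧ ¬PilotKummerIndRelated ∧ ¬Statement` ⇒ as a PREMISE 3.11.5 is «INSUFFICIENT» (holds-at-CM), and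
the clauses `Imp3115` / `Imp3115SheIpl` are FALSE there as typed; the datum-level IPL (`Cor312Vol.PilotKummerCompat`, p420303) closes
the Statement WITHOUT 3.11.5 (`statement_of_pilotKummerCompat`) and fails at CM (`not_pilotKummerCompat_pinnedSetting`) — the 4th △'s
content is the residual S, BY NAME (tst-2: `CandMochizuki4.H_iff_S_of_pinned3` p427897). [claim: Mochizuki2012, status: disputed]
-/

noncomputable section

open Set

namespace Summit.ABC.IUTFork.Repair.CandMochizukiSlides3115

open Thm311 Cor312 Cor312Vol Literature.IUT.LogThetaLattice

variable {T : ThetaIndex}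

/-! ## 1. The row, typed -/

section Typing

variable {S : Situation T} (P : Cor312.Setting S)

/-- **`HullDet` — «hull+det» applied to the multiradial representation, AS A PROPOSITION** (slides 2026-04 p. 10 l. 37–43 «a certain
elementary operation “hull+det” (obtained essentially by taking the determinant of the module over a ring generated by a certain
topological module that appears in the multiradial representation)»; [IUTchIII] Rmk. 3.9.5 (vii) (Ob2) hull / (Ob3) det^{⊗M} /
(Ob3-3) «the arithmetic degree … may be interpreted … as the log-volume», p. 131 l. 36 – p. 133 l. 8): the hull of the union of the
possible images and its determinant = log-volume are FORMED, i.e. «−|log(Θ)| ∈ ℝ» — BY NAME the frozen `Cor312.Setting.ThetaFinite`.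
Θ-side only; a claim-tagged HYPOTHESIS of the row, never asserted. [claim: Mochizuki2012, status: disputed] -/
@[claim "Mochizuki2012" "disputed"]
def HullDet : Prop := P.ThetaFinite

/-- `HullDet` IS `ThetaFinite`, by name. [folklore] -/
theorem hullDet_iff_thetaFinite : HullDet P ↔ P.ThetaFinite := Iff.rfl

end Typing

section Recut

variable (F : FullSituation T) (P : Cor312.Setting F.toLatticeSituation.toSituation)
  (ρ : (∀ v : T.V, v ∈ T.Vbad → Set (F.L.StarPacket v)) → ∀ (j : T.Label) (vQ : T.VQ), Set (F.L.Packet j vQ))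
  (qK : ∀ v : T.V, v ∈ T.Vbad → Set (F.L.StarPacket v))

/-- **«3.11.5» := «3.11 + Rmk. 3.9.5»** (slides 2026-04 p. 11 l. 28–31 «although in fact “3.11.5 (= 3.11 + Rmk. 3.9.5)” never appears in
[IUTchI-IV]! … obtained by “moving” the “hull+det” in 3.12 to “3.11.5”»): the typed Theorem 3.11 (`Thm311.FullSituation.Statement`)
together with `HullDet`. HYPOTHESIS of the row; never asserted. [claim: Mochizuki2012, status: disputed] -/
@[claim "Mochizuki2012" "disputed"]
def Thm3115 : Prop := F.Statement ∧ HullDet P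

/-- **«3.11.5⁺»** — the container strengthening of abc-iut-rcat-tst-2's pre-work (KERNEL-CLOSE-REF-LIT.md §6 row A8): 3.11.5 together
with RP-I05 `CandInternal2.HInd3Hull` (Θ-side hull/(Ind3) container reading). HYPOTHESIS; never asserted. [claim: Mochizuki2012, status: disputed] -/
@[claim "Mochizuki2012" "disputed"]
def Thm3115Plus : Prop := Thm3115 F P ∧ CandInternal2.HInd3Hull F.toLatticeSituation P ρ

/-- **«3.11.5 ⟹ 3.12» AS A CLAUSE** (the 4th △ of the slide, p. 11 l. 25–27 «We shall refer to this final portion as “3.11.5 ⟹ 3.12”»):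
the typed 3.11.5 implies the typed Statement of Cor. 3.12. HYPOTHESIS; never asserted. [claim: Mochizuki2012, status: disputed] -/
@[claim "Mochizuki2012" "disputed"]
def Imp3115 : Prop := Thm3115 F P → P.Statement

/-- **«3.11.5 =[SHE + IPL]⇒ 3.12»** (closing diagram of p. 11) with «SHE» (simultaneous holomorphic expressibility: the q-pilot read in
the common container from its own data) typed as PR-1's q-pin and «IPL» (input prime-strip link) typed at OBJECT level as PR-1's link
pin — together the frozen `Cor312Vol.PinnedRegions3` (p418935). HYPOTHESIS; never asserted. The DATUM-level reading of IPL is the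
frozen `Cor312Vol.PilotKummerCompat` (p420303), treated in §4. [claim: Mochizuki2012, status: disputed] -/
@[claim "Mochizuki2012" "disputed"]
def Imp3115SheIpl : Prop := Thm3115 F P → PinnedRegions3 F.toLatticeSituation P ρ qK → P.Statement

/-- 3.11.5⁺ contains 3.11.5. [folklore] -/
theorem thm3115_of_plus (h : Thm3115Plus F P ρ) : Thm3115 F P := h.1

/-! ## 2. `HullDet` is necessary and cheap -/

/-- The typed Statement already contains `HullDet` (its first conjunct «−|log(Θ)| ∈ ℝ»; abc-iut-c312-7's `thetaFinite_of_statement`).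
[folklore] -/
theorem hullDet_of_statement (h : P.Statement) : HullDet P := P.thetaFinite_of_statement h

/-- The bridge hypotheses of record contain `HullDet` (field `finite`). [folklore] -/
theorem hullDet_of_bridgeHyps (H : BridgeHyps P) : HullDet P := H.finite

/-- Hence under the bridge hypotheses, 3.11.5 is just the typed Theorem 3.11. [folklore] -/
theorem thm3115_iff_thm311_of_bridgeHyps (H : BridgeHyps P) : Thm3115 F P ↔ F.Statement :=
  ⟨fun h => h.1, fun h => ⟨h, hullDet_of_bridgeHyps F P H⟩⟩

/-! ## 3. k4: given 3.11.5, the clause «3.11.5 ⟹ 3.12» IS the Statement -/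

/-- **k4 (restates the Statement)**: wherever 3.11.5 holds, the clause «3.11.5 ⟹ 3.12» is equivalent to the typed Statement itself —
the re-cut relocates the whole disputed content into the 4th △. [folklore] -/
theorem imp3115_iff_statement (h : Thm3115 F P) : Imp3115 F P ↔ P.Statement :=
  ⟨fun hi => hi h, fun hs _ => hs⟩

/-- The same for the «SHE + IPL» form wherever 3.11.5 and the three pins hold. [folklore] -/
theorem imp3115SheIpl_iff_statement (h : Thm3115 F P) (hpin : PinnedRegions3 F.toLatticeSituation P ρ qK) :
    Imp3115SheIpl F P ρ qK ↔ P.Statement :=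
  ⟨fun hi => hi h hpin, fun hs _ _ => hs⟩

/-- With IPL read at DATUM level (`Cor312Vol.PilotKummerCompat`), the door to the Statement is abc-iut-w5-d068's
`statement_of_pilotKummerCompat` and does NOT use 3.11.5's `HullDet` (nor Thm. 3.11): the premise 3.11.5 is idle in that door.
[claim: Mochizuki2012, status: disputed] -/
theorem statement_of_she_iplDatum (_h : Thm3115 F P) (H : BridgeHyps P) (hpin : PinnedRegions3 F.toLatticeSituation P ρ qK)
    (hc : PilotKummerCompat F.toLatticeSituation P qK) : P.Statement :=
  statement_of_pilotKummerCompat F.toLatticeSituation P ρ qK H hpin hc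

end Recut

/-! ## 4. T-b at the pinned countermodel of record (every prime `p`; `p = 2` literally) -/

section Pinned

open Cor312.Checks Cor312.IdentifiedNonVacuity Cor312Vol.NaiveWitness Cor312Vol.PinnedWitness

variable (p : ℕ) [hp : Fact p.Prime]

/-- `HullDet` HOLDS at the pinned countermodel (its bridge hypotheses hold there, p419720). [folklore] -/
theorem hullDet_pinnedSetting : HullDet (pinnedSetting p) := (pinnedSetting_bridgeHyps p).finite

/-- **3.11.5 HOLDS at the pinned countermodel** (typed Thm. 3.11 `naiveFull_statement` ∧ `HullDet`). [folklore] -/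
theorem thm3115_pinnedSetting : Thm3115 (naiveFull p) (pinnedSetting p) :=
  ⟨naiveFull_statement p, hullDet_pinnedSetting p⟩

/-- **3.11.5⁺ HOLDS at the pinned countermodel** (RP-I05 holds there: abc-iut-rp-d2's `CandInternal2.hInd3Hull_pinnedSetting`). [folklore] -/
theorem thm3115Plus_pinnedSetting : Thm3115Plus (naiveFull p) (pinnedSetting p) (orbitRegion p) :=
  ⟨thm3115_pinnedSetting p, CandInternal2.hInd3Hull_pinnedSetting p⟩

/-- **The clause «3.11.5 ⟹ 3.12» is FALSE at the pinned countermodel** (3.11.5 holds, the Statement fails). [folklore] -/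
theorem not_imp3115_pinnedSetting : ¬ Imp3115 (naiveFull p) (pinnedSetting p) := fun h =>
  pinnedSetting_not_statement p (h (thm3115_pinnedSetting p))

/-- **… and so is «3.11.5 =[SHE + IPL]⇒ 3.12» with SHE = q-pin and IPL = object-level link pin** (all three pins hold there,
`pinnedSetting_pinnedRegions3`). [folklore] -/
theorem not_imp3115SheIpl_pinnedSetting :
    ¬ Imp3115SheIpl (naiveFull p) (pinnedSetting p) (orbitRegion p) (qDatum p) := fun h =>
  pinnedSetting_not_statement p (h (thm3115_pinnedSetting p) (pinnedSetting_pinnedRegions3 p))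

/-- **`HullDet` is none of the comparison clauses**: at the pinned countermodel `HullDet` holds while the S_H hull clause
(`not_pilotKummerCompatHull_pinnedSetting`), the global volume transport (`EvalComparison.pinnedSetting_not_globalVolumeTransport`) and
the (xi-f) `Licence` (`pinnedSetting_not_licence`) all fail — so typed Thm. 3.11 + pins + HullDet derive none of them. [folklore] -/
theorem hullDet_and_not_comparison_pinnedSetting :
    HullDet (pinnedSetting p) ∧
      ¬ PilotKummerCompatHull (naiveFull p).toLatticeSituation (pinnedSetting p) (orbitRegion p) (qDatum p) ∧
      ¬ GlobalVolumeTransport (S := (naiveFull p).toLatticeSituation.toSituation) (pinnedSetting p) ∧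
      ¬ Thm311ToCor312.Licence (pinnedSetting p) :=
  ⟨hullDet_pinnedSetting p, not_pilotKummerCompatHull_pinnedSetting p, EvalComparison.pinnedSetting_not_globalVolumeTransport p,
    pinnedSetting_not_licence p⟩

/-- The datum-level IPL fails at the pinned countermodel (abc-iut-w5-d068, by name) while 3.11.5⁺ holds there: the 4th △'s content is
not supplied by 3.11.5. [folklore] -/
theorem thm3115Plus_and_not_iplDatum_pinnedSetting :
    Thm3115Plus (naiveFull p) (pinnedSetting p) (orbitRegion p) ∧
      ¬ PilotKummerCompat (naiveFull p).toLatticeSituation (pinnedSetting p) (qDatum p) :=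
  ⟨thm3115Plus_pinnedSetting p, not_pilotKummerCompat_pinnedSetting p⟩

/-- **RC-308 KERNEL-CLOSE, PACKAGED (REPAIR-SPEC §2 shape, `p = 2`)**: an instantiation with typed Thm. 3.11 ∧ `HullDet` (= 3.11.5) ∧
RP-I05 (= 3.11.5⁺) ∧ BridgeHyps ∧ |log(q)| > 0 ∧ the three pins (SHE + object-level IPL) where the S_H hull clause, the global volume
transport, the residual S, the (xi-f) licence, the Statement and both typed forms of «3.11.5 ⟹ 3.12» FAIL. As a premise 3.11.5 is
INSUFFICIENT at OUR interface; the 4th △ carries the entire residual. No judgement on print. [folklore] -/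
theorem thm3115_insufficient :
    ∃ (T : ThetaIndex) (F : FullSituation T) (P : Cor312.Setting F.toLatticeSituation.toSituation)
      (ρ : (∀ v : T.V, v ∈ T.Vbad → Set (F.L.StarPacket v)) → ∀ (j : T.Label) (vQ : T.VQ), Set (F.L.Packet j vQ))
      (qK : ∀ v : T.V, v ∈ T.Vbad → Set (F.L.StarPacket v)),
      Thm3115 F P ∧ Thm3115Plus F P ρ ∧ BridgeHyps P ∧ P.AbsLogQPos ∧ PinnedRegions3 F.toLatticeSituation P ρ qK ∧
        ¬ PilotKummerCompatHull F.toLatticeSituation P ρ qK ∧ ¬ GlobalVolumeTransport P ∧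
        ¬ PilotKummerIndRelated F.toLatticeSituation P ρ qK ∧ ¬ Thm311ToCor312.Licence P ∧ ¬ P.Statement ∧
        ¬ Imp3115 F P ∧ ¬ Imp3115SheIpl F P ρ qK := by
  haveI : Fact (Nat.Prime 2) := ⟨Nat.prime_two⟩
  exact ⟨toyIndex, naiveFull 2, pinnedSetting 2, orbitRegion 2, qDatum 2, thm3115_pinnedSetting 2, thm3115Plus_pinnedSetting 2,
    pinnedSetting_bridgeHyps 2, pinnedSetting_absLogQPos 2, pinnedSetting_pinnedRegions3 2, not_pilotKummerCompatHull_pinnedSetting 2,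
    EvalComparison.pinnedSetting_not_globalVolumeTransport 2, pinnedSetting_not_pilotKummerIndRelated 2, pinnedSetting_not_licence 2,
    pinnedSetting_not_statement 2, not_imp3115_pinnedSetting 2, not_imp3115SheIpl_pinnedSetting 2⟩

end Pinned

end Summit.ABC.IUTFork.Repair.CandMochizukiSlides3115

end
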